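import Summits.AtomisticToContinuum.Crystallization.Theorems.OverbindingBudgetAffinePhaseCut
import Literature.MathematicalPhysics.StatisticalMechanics.LennardJonesHcpBelowFcc

/-!
(SPLIT FOR THE 400-LINE CAP by the landing lane, hand-2 g35: this file = part 1 of 2; sequels `…OverbindingBudgetAffineCushionCut` import it in a chain; same namespace, all FQNs unchanged.)
# Overbinding budget — «CushionCut»: the cubic leaves of the PhaseCut cut BY THE FCC CUSHION (decomp-a2c lens-4, generation 76)

Child of `…Theorems.OverbindingBudgetAffinePhaseCut` (lens-4 g75, critic row 1321 CLEARED · ADMITTED AS RECORD: slot-3 kernel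
`MR := TameBalancedAffMidGap 64 12 (1/10⁵) (1/25) (3/50) (1/450) ⟸ QH ∧ QC ∧ PM`, transfer target `HexagonalDominance` (HD) with HD ⇒ QC ∧ PM).
Imports ONLY the g75 tree node and the Literature certificate `…LennardJonesHcpBelowFcc` (`lennardJones_hcp_below_fcc`:
`e(hcp₀) + 723/10⁷ ≤ e(fcc a, a√(2/3))` for an explicit ideal hcp lattice `hcp₀` and EVERY cubic fcc scale `a`); restates nothing.

## The lens-4 move of this generation (minimal counterexample / extremal reduction)

A minimal counterexample to a CUBIC leaf (QC: rough sites inside pure-cubic `r`-balls; PM: rough sites seeing both letters) is pushed to its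
normal form by REMOVING ROUGHNESS: smoothing a pure-fcc ball can only LOWER the energy towards the fcc lattice energy, and that lattice energy is
itself SEPARATED from the ground-state energy per particle `e⋆ := ⨅_Q e(Q)` by the certified STACKING CUSHION
`e(fcc) − e⋆ ≥ 723/10⁷` (`cushion_le_fcc_energyPerParticle`, PROVED here from the Literature certificate and `e⋆ ≤ e(hcp)`).
Hence the extremiser of QC is IDEAL CUBIC FCC ITSELF, where nothing is rough and the inequality still holds with room `723/10⁷` per site:
the roughness conjunct of QC carries no difficulty of its own.  Typed, this is the cut

* **KF** `TameBalancedFccBallGap ρ ε g r` («cubic cushion», NEW · UNDECIDED · TRUE-type): `∃ c > 0` per `(ρ,ε)`-deeply registered site whose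
  `r`-ball is PURE CUBIC (a cubic-lettered site within `r·nn`, no hexagonal-lettered one), against `#¬deep + #off + N^{2/3} + gains` —
  NO affine ladder, NO fine tolerance `ε_h = 10⁻⁵`, NO amplitude `θ`, NO roughness: three parameters fewer than QC.
  `KF_W ⇒ QC_W` (`balancedFccRoughGapW_of_fccBallGapW`, the priced set of QC is a subset, its rebate a superset).
* **FF** `TameFccFloor ρ ε g r` («fcc floor», NEW · UNDECIDED · TRUE-type, the SHARP / gain-0 form): every pure-cubic-ball deep site pays the
  EXPLICIT rate `e(fcc a, a√(2/3)) − e⋆` for some cubic fcc scale `a` (the prover takes the optimal one), everyone else pays `e⋆`, same rebates.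
  `FF_W ⇒ KF_W` (`balancedFccBallGapW_of_fccFloorW`: the rate is positive BY THE CERTIFIED CUSHION — this is where `723/10⁷` is load-bearing).
* **HI** `TameBalancedInterfaceCubicGap ρ ε g r` («interface dominance», NEW · UNDECIDED · TRUE-type modulo the interface layer gap): `∃ c > 0`
  per cubic-lettered site lying in the `r`-ball of a `ρ`-deep site whose `r`-ball also contains a hexagonal-lettered site (the cubic letters AT
  STACKING INTERFACES), same rebates.  `HI_W ⇒ PM_W` (`balancedMixedRoughGapW_of_interfaceCubicGapW`, shadow packing of part A BY NAME's pattern).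

and the transfer target of g75 SPLITS LOSSLESSLY along the same line:

* **HD ⟺ KF ∧ HI** at the record frame (`hexagonalDominance_iff_cubicCushion_and_interfaceDominance`, PROVED): a deeply registered cubic letter
  either sits in a pure-cubic ball (KF) or sees a hexagonal letter (HI) (`cubicCount_le_fccBall_add_interfaceCubic`, excluded middle), glued by
  g41's `convexComb_core` BY NAME and by the DEPTH NORMAL FORM `balancedCubicGapW_of_depth` (HD at depth 4 ⟸ HD at depth 64: the 64-shadow of the
  defects is count-charged to the 4-rebate by g74's `notDeepCount_depth_le` BY NAME — the lens-4 «a minimal counterexample is defect-free out to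
  any fixed radius»); conversely `HD ⇒ KF` and `HD ⇒ HI` (subset pricing + `deepReg_of_near`).

Record cones (PROVED, BY NAME on g75/g74): `MR ⟸ QH ∧ KF ∧ HI` (`tameBalancedAffMidGap_of_cushionCut`), hence the slot-3 cone
`tbdsg_of_cushionCut_record` and the RDEF cone `rdef_of_ceg_shape_cushionCut_record` with `(QH, CubicCushion, InterfaceDominance)` in place of MR.

The untouched blocker QH gets its lens-4 reduction theorem (§6, PROVED): `QH_W(L) ⇒ QH_W(ρ)` for `0 ≤ ρ ≤ L` (`balancedHexRoughGapW_of_depth`) — pricing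
pure-hexagonal-ball roughness at sites registered out to ANY radius `L` suffices, so a minimal counterexample to QH is a locally perfect, smoothly
modulated hexagonal crystal (memo §5: the extremisers are frozen zone-boundary phonons of hcp at amplitude `ε_h`; the rigid-misfit normal form is a
TRAP because the relaxed Lennard-Jones hcp axial ratio deviates from ideal by `1.4·10⁻⁴ ≫ ε_h = 10⁻⁵`, census C30).

WHY STRICTLY WEAKER THAN THE SUMMIT: KF, FF, HI are each implied by `HexagonalDominance`-type statements about REGISTERED matter only and say nothing about
unregistered matter, vacancies, surfaces or the `N^{2/3}` term (all rebated); none implies MR, TBDSG or RDEF (probe battery `HOME/…/g76/bc/probes_cushion.lean`).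
WHY NOT WEAKER THAN THEIR PARENTS (honest tag LATERAL·STRONGER): KF ⇒ QC and HI ⇒ PM, not conversely — they price SMOOTH cubic matter too.  The claim of
this node is not logical weakness but REDUCTION OF DIFFICULTY: the cushion `723/10⁷` replaces strict stability of a rough phase (QC's `c` had to come
from the roughness itself, at second order in a `10⁻⁵` non-affinity, i.e. `c_QC ≲ 10⁻¹⁰`) by a ZEROTH-ORDER gap (`c_KF ≈ 7·10⁻⁵`), and the priced set
becomes a union of whole pure-cubic regions (localisation at scale `r`, no `10⁻⁵` threshold to resolve).  Every proof of QC known to us goes through FF.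

0 sorry · Mathlib + tree only · no new axioms · no instance / notation beyond the tree's file-local `E3`.
Memo: `HOME/decomp-a2c-lens-4/g76/memo/NODE-g76-CushionCut.md`.  Probes: `HOME/…/g76/bc/probes_cushion.lean`, `bc7_cushion.lean`.
-/

namespace Summit.AtomisticToContinuum.Crystallization.Theorems.OverbindingBudgetAffineCushionCut

open scoped BigOperators Classical
open Literature.MathematicalPhysics.StatisticalMechanics
open Literature.Geometry.DiscreteGeometry (IsChargeFree nearestDist nearestDist_nonneg nearestDist_le_dist fccTwoShellPattern hcpTwoShellPattern)
open Summit.AtomisticToContinuum.Crystallization.Theorems.OverbindingBudgetMisfitCensusStatements (card_le_of_cube)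
open Summit.AtomisticToContinuum.Crystallization.Theorems.OverbindingBudgetMisfitRegistration (Framed Reg DeepReg)
open Summit.AtomisticToContinuum.Crystallization.Theorems.OverbindingBudgetMisfitWindowStatements (InWindow offCount)
open Summit.AtomisticToContinuum.Crystallization.Theorems.OverbindingBudgetBalancedCensusStatements
open Summit.AtomisticToContinuum.Crystallization.Theorems.OverbindingBudgetHarmonicNormalForm (convexComb_core)
open Summit.AtomisticToContinuum.Crystallization.Theorems.OverbindingBudgetAffineLadder
open Summit.AtomisticToContinuum.Crystallization.Theorems.OverbindingBudgetAffineMesoCut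
open Summit.AtomisticToContinuum.Crystallization.Theorems.OverbindingBudgetAffinePhaseCut

variable {N : ℕ}

local notation "E3" => EuclideanSpace ℝ (Fin 3)

/-! ## §1  The two new counts and the counting identities (PROVED) -/

/-- Number of PURE-CUBIC-BALL deep sites: `(ρ, ε)`-deeply registered, a cubic-lettered site within `r·nn`, NO hexagonal-lettered site within `r·nn`
(the priced set of KF and FF; QC's priced set without its roughness conjunct). -/
noncomputable def fccBallCount (ρ ε g r : ℝ) (y : Fin N → E3) : ℕ :=
  Nat.card {i : Fin N // DeepReg ρ ε g y i ∧ CNear r ε g y i ∧ ¬ HNear r ε g y i}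

/-- Number of INTERFACE CUBIC-LETTERED sites: cubic-lettered sites `j` lying in the `r`-ball of some `(ρ, ε)`-deep site `i` whose `r`-ball also
contains a hexagonal-lettered site (the priced set of HI; the anchor `i` carries the metric data, so no comparison of `nn_i` and `nn_j` is needed). -/
noncomputable def interfaceCubicCount (ρ ε g r : ℝ) (y : Fin N → E3) : ℕ :=
  Nat.card {j : Fin N // CFramed ε g y j ∧ ∃ i : Fin N, DeepReg ρ ε g y i ∧ dist (y j) (y i) ≤ r * nearestDist y i ∧ HNear r ε g y i}

/-- `#fccRough ≤ #fccBall` (drop the roughness conjunct). [this file] -/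
theorem fccRoughCount_le_fccBallCount {ρ ρ₁ ε₁ θ ε g r : ℝ} (y : Fin N → E3) :
    fccRoughCount ρ ρ₁ ε₁ θ ε g r y ≤ fccBallCount ρ ε g r y := by
  simp only [fccRoughCount, fccBallCount, Nat.card_eq_fintype_card, Fintype.card_subtype]
  apply Finset.card_le_card
  intro i hi
  rw [Finset.mem_filter] at hi ⊢
  exact ⟨hi.1, hi.2.1.1, hi.2.2⟩

/-- A pure-cubic-ball deep site is itself cubic-lettered (`cFramed_near_of_not_hNear` at `j = i`). [this file] -/
theorem cFramed_of_fccBall {ρ r ε g : ℝ} (hr0 : 0 ≤ r) (hr : r ≤ ρ) {y : Fin N → E3} {i : Fin N} (hi : DeepReg ρ ε g y i)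
    (hn : ¬ HNear r ε g y i) : CFramed ε g y i := by
  have h0 : dist (y i) (y i) ≤ r * nearestDist y i := by
    rw [dist_self]; exact mul_nonneg hr0 (nearestDist_nonneg y i)
  exact cFramed_near_of_not_hNear hr hi hn h0

/-- EXCLUDED MIDDLE ON HEXAGONAL PROXIMITY: `#cubic(ρ) ≤ #fccBall(ρ, r) + #interfaceCubic(ρ, r)` for `0 ≤ r` — a deeply registered cubic letter either
sees a hexagonal letter within `r` (then it is an interface cubic site, anchored at itself) or it does not (then its `r`-ball is pure cubic). [this file] -/
theorem cubicCount_le_fccBall_add_interfaceCubic {ρ ε g r : ℝ} (hr0 : 0 ≤ r) (y : Fin N → E3) :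
    cubicCount ρ ε g y ≤ fccBallCount ρ ε g r y + interfaceCubicCount ρ ε g r y := by
  simp only [cubicCount, fccBallCount, interfaceCubicCount, Nat.card_eq_fintype_card, Fintype.card_subtype]
  calc (Finset.univ.filter fun i => DeepReg ρ ε g y i ∧ CFramed ε g y i).card
      ≤ ((Finset.univ.filter fun i => DeepReg ρ ε g y i ∧ CNear r ε g y i ∧ ¬ HNear r ε g y i) ∪
          (Finset.univ.filter fun j => CFramed ε g y j ∧
            ∃ i : Fin N, DeepReg ρ ε g y i ∧ dist (y j) (y i) ≤ r * nearestDist y i ∧ HNear r ε g y i)).card := by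
        apply Finset.card_le_card
        intro i hi
        rw [Finset.mem_filter] at hi
        rw [Finset.mem_union, Finset.mem_filter, Finset.mem_filter]
        have h0 : dist (y i) (y i) ≤ r * nearestDist y i := by
          rw [dist_self]; exact mul_nonneg hr0 (nearestDist_nonneg y i)
        by_cases hH : HNear r ε g y i
        · exact Or.inr ⟨hi.1, hi.2.2, i, hi.2.1, h0, hH⟩
        · exact Or.inl ⟨hi.1, hi.2.1, ⟨i, h0, hi.2.2⟩, hH⟩
    _ ≤ _ := Finset.card_union_le _ _

/-- `#fccBall(ρ, r) ≤ #cubic(ρc)` for `ρc ≤ ρ`, `0 ≤ r ≤ ρ` (a pure-cubic-ball `ρ`-deep site is a `ρc`-deep cubic letter). [this file] -/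
theorem fccBallCount_le_cubicCount {ρ ρc ε g r : ℝ} (hρc : ρc ≤ ρ) (hr0 : 0 ≤ r) (hr : r ≤ ρ) (y : Fin N → E3) :
    fccBallCount ρ ε g r y ≤ cubicCount ρc ε g y := by
  simp only [cubicCount, fccBallCount, Nat.card_eq_fintype_card, Fintype.card_subtype]
  apply Finset.card_le_card
  intro i hi
  rw [Finset.mem_filter] at hi ⊢
  exact ⟨hi.1, deepReg_anti hρc hi.2.1, cFramed_of_fccBall hr0 hr hi.2.1 hi.2.2.2⟩

/-- `#interfaceCubic(ρ, r) ≤ #cubic(ρc)` for `1 ≤ r`, `0 ≤ ρc`, `r(ρc+1) ≤ ρ` (the anchor transfers depth: part A's `deepReg_of_near`). [this file] -/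
theorem interfaceCubicCount_le_cubicCount {ρ ρc ε g r : ℝ} (hr : 1 ≤ r) (hρc : 0 ≤ ρc) (hρ : r * (ρc + 1) ≤ ρ) (y : Fin N → E3) :
    interfaceCubicCount ρ ε g r y ≤ cubicCount ρc ε g y := by
  simp only [cubicCount, interfaceCubicCount, Nat.card_eq_fintype_card, Fintype.card_subtype]
  apply Finset.card_le_card
  intro j hj
  rw [Finset.mem_filter] at hj ⊢
  obtain ⟨-, hC, i, hD, hd, -⟩ := hj
  exact ⟨Finset.mem_univ _, deepReg_of_near hr hρc hρ hD hd, hC⟩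

/-- `#cubic(ρ) ≤ #cubic(L) + #¬L-deep` (a `ρ`-deep cubic letter is `L`-deep or not). [this file] -/
theorem cubicCount_depth_le {ρ L ε g : ℝ} (y : Fin N → E3) :
    cubicCount ρ ε g y ≤ cubicCount L ε g y + notDeepCount L ε g y := by
  simp only [cubicCount, notDeepCount, Nat.card_eq_fintype_card, Fintype.card_subtype]
  calc (Finset.univ.filter fun i => DeepReg ρ ε g y i ∧ CFramed ε g y i).card
      ≤ ((Finset.univ.filter fun i => DeepReg L ε g y i ∧ CFramed ε g y i) ∪
          (Finset.univ.filter fun i => ¬ DeepReg L ε g y i)).card := by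
        apply Finset.card_le_card
        intro i hi
        rw [Finset.mem_filter] at hi
        rw [Finset.mem_union, Finset.mem_filter, Finset.mem_filter]
        by_cases hD : DeepReg L ε g y i
        · exact Or.inl ⟨hi.1, hD, hi.2.2⟩
        · exact Or.inr ⟨hi.1, hD⟩
    _ ≤ _ := Finset.card_union_le _ _

/-- **Shadow packing onto the interface cubic letters**: `#mixedRough(ρ, r) ≤ 27(2rσ₂+σ₁)³/σ₁³ · #interfaceCubic(ρ, r) + #off` for `0 ≤ r`,
`0 < σ₁ ≤ σ₂` — an in-window two-letter-ball rough site `i` is the ANCHOR of its own cubic witness `j` (within `rσ₂` of `y j`), and in-window sites are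
`σ₁`-separated (`card_le_of_cube` BY NAME; the fibre argument of part A's `cubicRoughCount_le_cubicCount`). [this file] -/
theorem mixedRoughCount_le_interfaceCubicCount {ρ ρ₁ ε₁ θ ε g r σ₁ σ₂ : ℝ} (hr0 : 0 ≤ r) (hσ : 0 < σ₁) (hσσ : σ₁ ≤ σ₂)
    {y : Fin N → E3} (hy : Function.Injective y) :
    (mixedRoughCount ρ ρ₁ ε₁ θ ε g r y : ℝ)
      ≤ 27 / σ₁ ^ 3 * (2 * r * σ₂ + σ₁) ^ 3 * interfaceCubicCount ρ ε g r y + offCount σ₁ σ₂ y := by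
  classical
  set K : ℝ := 27 / σ₁ ^ 3 * (2 * r * σ₂ + σ₁) ^ 3 with hK
  set S : Finset (Fin N) := Finset.univ.filter
    (fun i => InWindow σ₁ σ₂ y i ∧ ((DeepReg ρ ε g y i ∧ ¬ AffDeepReg ρ₁ ε₁ θ g y i) ∧ CNear r ε g y i ∧ HNear r ε g y i)) with hS
  set B : Finset (Fin N) := Finset.univ.filter (fun j => CFramed ε g y j ∧
    ∃ i : Fin N, DeepReg ρ ε g y i ∧ dist (y j) (y i) ≤ r * nearestDist y i ∧ HNear r ε g y i) with hB
  set Of : Finset (Fin N) := Finset.univ.filter (fun i => ¬ InWindow σ₁ σ₂ y i) with hOf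
  have hPc : mixedRoughCount ρ ρ₁ ε₁ θ ε g r y =
      (Finset.univ.filter fun i => (DeepReg ρ ε g y i ∧ ¬ AffDeepReg ρ₁ ε₁ θ g y i) ∧ CNear r ε g y i ∧ HNear r ε g y i).card := by
    rw [mixedRoughCount, Nat.card_eq_fintype_card, Fintype.card_subtype]
  have hBc : interfaceCubicCount ρ ε g r y = B.card := by
    rw [interfaceCubicCount, Nat.card_eq_fintype_card, Fintype.card_subtype]
  have hOfc : offCount σ₁ σ₂ y = Of.card := by
    rw [offCount, Nat.card_eq_fintype_card, Fintype.card_subtype]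
  -- split the priced sites by the window
  have hsplit : (Finset.univ.filter fun i => (DeepReg ρ ε g y i ∧ ¬ AffDeepReg ρ₁ ε₁ θ g y i) ∧ CNear r ε g y i ∧ HNear r ε g y i).card
      ≤ S.card + Of.card := by
    calc (Finset.univ.filter fun i => (DeepReg ρ ε g y i ∧ ¬ AffDeepReg ρ₁ ε₁ θ g y i) ∧ CNear r ε g y i ∧ HNear r ε g y i).card
        ≤ (S ∪ Of).card := by
          apply Finset.card_le_card
          intro i hi
          rw [Finset.mem_filter] at hi
          rw [Finset.mem_union, Finset.mem_filter, Finset.mem_filter]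
          by_cases hw : InWindow σ₁ σ₂ y i
          · exact Or.inl ⟨hi.1, hw, hi.2⟩
          · exact Or.inr ⟨hi.1, hw⟩
      _ ≤ S.card + Of.card := Finset.card_union_le _ _
  -- the shadow fibres
  set T : Fin N → Finset (Fin N) := fun j => S.filter (fun i => dist (y i) (y j) ≤ r * σ₂) with hT
  have hcover : S ⊆ B.biUnion T := by
    intro i hi
    have hi' := (Finset.mem_filter.1 hi).2
    obtain ⟨⟨-, hhi⟩, ⟨hD, -⟩, ⟨j, hd, hjC⟩, hH⟩ := hi'
    rw [Finset.mem_biUnion]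
    refine ⟨j, Finset.mem_filter.2 ⟨Finset.mem_univ _, hjC, i, hD, hd, hH⟩, Finset.mem_filter.2 ⟨hi, ?_⟩⟩
    rw [dist_comm]
    exact hd.trans (mul_le_mul_of_nonneg_left hhi hr0)
  have hfib : ∀ j : Fin N, ((T j).card : ℝ) ≤ K := by
    intro j
    have hcardim : ((T j).image y).card = (T j).card := Finset.card_image_of_injective _ hy
    set o : E3 := WithLp.toLp 2 (fun k : Fin 3 => (y j) k - r * σ₂) with ho
    have hok : ∀ k : Fin 3, o k = (y j) k - r * σ₂ := fun k => rfl
    have hmem : ∀ z ∈ (T j).image y, ∀ k : Fin 3, o k ≤ z k ∧ z k < o k + (2 * r * σ₂ + σ₁) := by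
      intro z hz k
      rw [Finset.mem_image] at hz
      obtain ⟨i, hi, rfl⟩ := hz
      have hd : dist (y i) (y j) ≤ r * σ₂ := (Finset.mem_filter.1 hi).2
      have hk : |(y i) k - (y j) k| ≤ dist (y i) (y j) := by
        rw [← Real.dist_eq]
        exact PiLp.dist_apply_le (y i) (y j) k
      have habs := abs_le.1 (hk.trans hd)
      rw [hok]
      constructor <;> linarith [habs.1, habs.2]
    have hsep : ∀ z ∈ (T j).image y, ∀ w ∈ (T j).image y, z ≠ w → σ₁ ≤ dist z w := by
      intro z hz w hw hzw
      rw [Finset.mem_image] at hz hw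
      obtain ⟨i, hi, rfl⟩ := hz
      obtain ⟨i', hi', rfl⟩ := hw
      have hii : i' ≠ i := fun h => hzw (by rw [h])
      have hwin : InWindow σ₁ σ₂ y i := ((Finset.mem_filter.1 (Finset.mem_filter.1 hi).1).2).1
      exact hwin.1.trans (nearestDist_le_dist y hii)
    have hrσ : 0 ≤ r * σ₂ := mul_nonneg hr0 (by linarith)
    have h := card_le_of_cube (F := (T j).image y) (o := o) hσ (by linarith) hmem hsep
    rw [hcardim] at h
    rw [hK]
    exact h
  have h1 : S.card ≤ (B.biUnion T).card := Finset.card_le_card hcover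
  have h2 : (B.biUnion T).card ≤ ∑ j ∈ B, (T j).card := Finset.card_biUnion_le
  have h3 : (∑ j ∈ B, ((T j).card : ℝ)) ≤ ∑ j ∈ B, K := Finset.sum_le_sum (fun j _ => hfib j)
  rw [Finset.sum_const, nsmul_eq_mul] at h3
  have h12 : (S.card : ℝ) ≤ ∑ j ∈ B, ((T j).card : ℝ) := by exact_mod_cast h1.trans h2
  have hSK : (S.card : ℝ) ≤ K * B.card := by
    calc (S.card : ℝ) ≤ B.card * K := h12.trans h3
      _ = K * B.card := by ring
  have hsplit' : (mixedRoughCount ρ ρ₁ ε₁ θ ε g r y : ℝ) ≤ S.card + Of.card := by rw [hPc]; exact_mod_cast hsplit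
  rw [hBc, hOfc]
  linarith

/-! ## §2  THE STATEMENTS (census shape of the tree; NEW, UNDECIDED) -/

/-- **KF_W** («cubic cushion», one window): `c > 0` per `(ρ, ε)`-deeply registered site with a PURE-CUBIC `r`-ball (a cubic-lettered site within `r·nn`,
no hexagonal-lettered one), against `#¬(ρ,ε)-deep + #off + N^{2/3} + gains`.  No affine ladder, no fine tolerance, no amplitude, no roughness.
[this file · kind: statement] -/
def BalancedFccBallGapW (ρ ε g r σ₁ σ₂ : ℝ) : Prop :=
  ∃ c C : ℝ, 0 < c ∧ ∀ (N : ℕ) (y : Fin N → E3), Function.Injective y →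
    ∃ u : E3, ‖u‖ = 1 ∧
      (N : ℝ) * (⨅ Q : PeriodicConfiguration 3, Q.energyPerParticle lennardJones) + c * (fccBallCount ρ ε g r y : ℝ)
        - C * (notDeepCount ρ ε g y : ℝ) - C * (offCount σ₁ σ₂ y : ℝ) - C * (N : ℝ) ^ (2 / 3 : ℝ) - C * (dilGain y + shGain u y)
        ≤ interactionEnergy lennardJones y

/-- **KF** (tame): `BalancedFccBallGapW … δ 2` for every window `[δ, 2]`, `0 < δ ≤ 2`. -/
def TameBalancedFccBallGap (ρ ε g r : ℝ) : Prop :=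
  ∀ δ : ℝ, 0 < δ → δ ≤ 2 → BalancedFccBallGapW ρ ε g r δ 2

/-- **`CubicCushion`** — KF at the frame of record `(ρ, ε, g, r) = (64, 3/50, 1/450, 12)`. [this file · kind: statement] -/
def CubicCushion : Prop :=
  TameBalancedFccBallGap 64 (3 / 50) (1 / 450) 12

/-- **FF_W** («fcc floor», one window; the SHARP, gain-0 form of KF): for SOME cubic fcc scale `a` (`h = a√(2/3)`) and some `C`, every pure-cubic-ball
`(ρ, ε)`-deep site pays the EXPLICIT rate `e(fcc a h) − e⋆` above the ground-state energy per particle `e⋆`, everyone else pays `e⋆`, against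
`#¬(ρ,ε)-deep + #off + N^{2/3} + gains`.  Equality case = ideal cubic fcc (the lens-4 extremiser). [this file · kind: statement] -/
def FccFloorW (ρ ε g r σ₁ σ₂ : ℝ) : Prop :=
  ∃ (a h : ℝ) (ha : a ≠ 0) (hh : h ≠ 0), h = a * Real.sqrt (2 / 3) ∧ ∃ C : ℝ, ∀ (N : ℕ) (y : Fin N → E3), Function.Injective y →
    ∃ u : E3, ‖u‖ = 1 ∧
      (N : ℝ) * (⨅ Q : PeriodicConfiguration 3, Q.energyPerParticle lennardJones)
        + ((fccPeriodicConfiguration ha hh).energyPerParticle lennardJones - ⨅ Q : PeriodicConfiguration 3, Q.energyPerParticle lennardJones)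
          * (fccBallCount ρ ε g r y : ℝ)
        - C * (notDeepCount ρ ε g y : ℝ) - C * (offCount σ₁ σ₂ y : ℝ) - C * (N : ℝ) ^ (2 / 3 : ℝ) - C * (dilGain y + shGain u y)
        ≤ interactionEnergy lennardJones y

/-- **FF** (tame). -/
def TameFccFloor (ρ ε g r : ℝ) : Prop :=
  ∀ δ : ℝ, 0 < δ → δ ≤ 2 → FccFloorW ρ ε g r δ 2

/-- **`FccFloor`** — FF at the frame of record `(64, 3/50, 1/450, 12)`. [this file · kind: statement] -/
def FccFloor : Prop :=
  TameFccFloor 64 (3 / 50) (1 / 450) 12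

/-- **HI_W** («interface dominance», one window): `c > 0` per cubic-lettered site lying in the `r`-ball of a `(ρ, ε)`-deep site whose `r`-ball also contains a
hexagonal-lettered site, against `#¬(ρ,ε)-deep + #off + N^{2/3} + gains` — cubic stacking AT AN INTERFACE with hexagonal stacking is never free.
[this file · kind: statement] -/
def BalancedInterfaceCubicGapW (ρ ε g r σ₁ σ₂ : ℝ) : Prop :=
  ∃ c C : ℝ, 0 < c ∧ ∀ (N : ℕ) (y : Fin N → E3), Function.Injective y →
    ∃ u : E3, ‖u‖ = 1 ∧
      (N : ℝ) * (⨅ Q : PeriodicConfiguration 3, Q.energyPerParticle lennardJones) + c * (interfaceCubicCount ρ ε g r y : ℝ)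
        - C * (notDeepCount ρ ε g y : ℝ) - C * (offCount σ₁ σ₂ y : ℝ) - C * (N : ℝ) ^ (2 / 3 : ℝ) - C * (dilGain y + shGain u y)
        ≤ interactionEnergy lennardJones y

/-- **HI** (tame). -/
def TameBalancedInterfaceCubicGap (ρ ε g r : ℝ) : Prop :=
  ∀ δ : ℝ, 0 < δ → δ ≤ 2 → BalancedInterfaceCubicGapW ρ ε g r δ 2

/-- **`InterfaceDominance`** — HI at the frame of record `(64, 3/50, 1/450, 12)`. [this file · kind: statement] -/
def InterfaceDominance : Prop :=
  TameBalancedInterfaceCubicGap 64 (3 / 50) (1 / 450) 12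

/-! ## §3  THE CERTIFIED CUSHION (PROVED): `e⋆ + 723/10⁷ ≤ e(fcc a, a√(2/3))` for every cubic fcc scale -/

/-- **The stacking cushion above the ground-state energy**: for every cubic fcc lattice (`h = a√(2/3)`, any scale `a ≠ 0`),
`(⨅_Q e(Q)) + 723/10⁷ ≤ e(fcc a h)` — the Literature certificate `lennardJones_hcp_below_fcc` (`e(hcp₀) + 723/10⁷ ≤ e(fcc a h)` for an explicit ideal
hcp `hcp₀`) and `⨅_Q e(Q) ≤ e(hcp₀)` (`ciInf_le`, `ChargedEnergyGapNegative.bddBelow_energyPerParticle_lennardJones`). [this file] -/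
theorem cushion_le_fcc_energyPerParticle {a h : ℝ} (ha : a ≠ 0) (hh : h ≠ 0) (hha : h = a * Real.sqrt (2 / 3)) :
    (⨅ Q : PeriodicConfiguration 3, Q.energyPerParticle lennardJones) + 723 / 10 ^ 7
      ≤ (fccPeriodicConfiguration ha hh).energyPerParticle lennardJones := by
  obtain ⟨a₀, h₀, ha₀, hh₀, -, -, hgap⟩ := lennardJones_hcp_below_fcc
  have hinf : (⨅ Q : PeriodicConfiguration 3, Q.energyPerParticle lennardJones)
      ≤ (hcpPeriodicConfiguration ha₀ hh₀).energyPerParticle lennardJones :=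
    ciInf_le ChargedEnergyGapNegative.bddBelow_energyPerParticle_lennardJones _
  linarith [hgap a h ha hh hha]

/-- The FF rate is positive: `0 < e(fcc a, a√(2/3)) − ⨅_Q e(Q)` (indeed `≥ 723/10⁷`). [this file] -/
theorem fccRate_pos {a h : ℝ} (ha : a ≠ 0) (hh : h ≠ 0) (hha : h = a * Real.sqrt (2 / 3)) :
    0 < (fccPeriodicConfiguration ha hh).energyPerParticle lennardJones - ⨅ Q : PeriodicConfiguration 3, Q.energyPerParticle lennardJones := by
  have := cushion_le_fcc_energyPerParticle ha hh hha
  linarith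

end Summit.AtomisticToContinuum.Crystallization.Theorems.OverbindingBudgetAffineCushionCut
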